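import Literature.Analysis.FluidPDE.NSLerayRegularisedLimitHolds
import Literature.Analysis.FluidPDE.WeakGradientSlicing
import Literature.Analysis.FluidPDE.MollifiedLimits
import Literature.Analysis.FluidPDE.SpaceTimeMollifier
import Literature.Analysis.FunctionSpaces.SpaceTimeWeakCompactness
import Literature.Analysis.FunctionSpaces.SobolevDomainProofs
import HarnessLib

/-!
# Weak spatial gradients from smooth approximations with bounded dissipation

Analysis/FluidPDE support file (theorem-only; serves the discharge of
`SereginSverak2009.GradientEnergyBound`, Seregin–Šverák 2009, proof of Lemma 3.5, (as6) with
Remark 3.4: the velocity of a local solution bounded away from the final time has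
`∇v ∈ L²` on interior cylinders).

Let `Ω ⊆ ℝ × E` be an open space–time region, `u : ℝ → E → E` locally integrable on `Ω`, and
`Vₙ : ℝ → E → E` jointly `C¹` fields converging to `u` in `L¹` on every compact subset of `Ω`
whose spatial gradients have uniformly bounded dissipation on `Ω`,
`∫∫_Ω |D_x Vₙ|² ≤ L < ∞`. Then `u` has a weak spatial gradient `G` on `Ω`
(accepted `HasWeakSpatialGradientOn`, Caffarelli–Kohn–Nirenberg 1982, (2.1)) with
`∫∫_Ω |G|² ≤ L` (`exists_hasWeakSpatialGradientOn_of_lintegral_fderiv_le`).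

Proof (Evans, *PDE*, §5.2.1 with Brezis 2011, Thm. 3.18 / Prop. 3.5 (iii)): the gradient tuples
`(D_x Vₙ bᵢ)ᵢ` form a bounded sequence in the separable Hilbert space `L²(Ω; E^d)`; a
subsequence converges weakly (`FunctionSpaces.exists_strictMono_tendsto_inner_of_norm_le`) to
some `g` with `‖g‖ ≤ L^{1/2}`; `G` is the operator field assembled from `g`
(`tupleToCLM`, `GradTuple` of `NSLerayRegularisedLimitHolds`); the classical integration by
parts of the slices `Vₙ(t, ·)` (`FunctionSpaces.HasWeakFDerivOn.of_contDiff_holds`) passes to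
the limit — strongly on the side of the fields, weakly on the side of the gradients tested
against the tuple fields `((⟪bᵢ, v⟫ φ) • w)ᵢ` (`testTuple`).

## Mathlib search

Mathlib (this pin) has no weak derivatives and no sequential weak compactness for bounded
sequences in Hilbert spaces; the tree supplies both (see the imports). No new definitions
(the limit operator field is `tupleToCLM (fun _ => g z) 0` for the accepted `tupleToCLM`).

## References

* L. C. Evans, *Partial Differential Equations*, 2nd ed. (AMS 2010), §5.2.1.
* H. Brezis, *Functional Analysis, Sobolev Spaces and Partial Differential Equations*
  (Springer 2011), Thm. 3.18, Prop. 3.5 (iii).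
* L. Caffarelli, R. Kohn, L. Nirenberg, *Partial regularity of suitable weak solutions of the
  Navier–Stokes equations*, Comm. Pure Appl. Math. 35 (1982), (2.1).
-/

noncomputable section

open MeasureTheory TopologicalSpace Set Function Filter Metric
open scoped RealInnerProductSpace ENNReal NNReal Topology

namespace Literature.Analysis.FluidPDE

variable {E : Type*} [NormedAddCommGroup E] [InnerProductSpace ℝ E] [FiniteDimensional ℝ E]
  [MeasurableSpace E] [BorelSpace E]

/-! ### Space–time forms of the tuple calculus -/

section Tuple

omit [MeasurableSpace E] [BorelSpace E] in
/-- The operator assembled from a constant tuple field does not depend on the base point: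
`tupleToCLM (fun _ => γ) x = tupleToCLM (fun _ => γ) 0`. [folklore] -/
theorem tupleToCLM_const_eq (γ : GradTuple E) (x : E) :
    tupleToCLM (fun _ : E => γ) x = tupleToCLM (fun _ : E => γ) 0 := rfl

omit [MeasurableSpace E] [BorelSpace E] in
/-- `γ ↦ tupleToCLM (fun _ => γ) 0` is continuous (a finite sum of continuous linear
operations). [folklore] -/
theorem continuous_tupleToCLM_const :
    Continuous fun γ : GradTuple E => tupleToCLM (fun _ : E => γ) 0 := by
  have heq : (fun γ : GradTuple E => tupleToCLM (fun _ : E => γ) 0) = fun γ => ∑ i,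
      (innerSL ℝ (stdOrthonormalBasis ℝ E i)).smulRight (γ.ofLp i) := rfl
  rw [heq]
  refine continuous_finsetSum _ fun i _ => ?_
  exact (ContinuousLinearMap.smulRightL ℝ E E (innerSL ℝ (stdOrthonormalBasis ℝ E i))).continuous.comp
    (PiLp.continuous_apply 2 _ i)

omit [MeasurableSpace E] [BorelSpace E] in
/-- `‖gradTuple (V t) x‖ₑ² = ofReal |D_x V|²(t, x)` (space–time form of `enorm_gradTuple_sq`).
[folklore] -/
theorem enorm_gradTuple_slice_sq (V : ℝ → E → E) (z : ℝ × E) :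
    ‖gradTuple (V z.1) z.2‖ₑ ^ 2 = ENNReal.ofReal (frobeniusNormSq (fderiv ℝ (V z.1) z.2)) :=
  enorm_gradTuple_sq (V z.1) z.2

omit [FiniteDimensional ℝ E] [MeasurableSpace E] [BorelSpace E] in
/-- The spatial derivative of the slices of a jointly `C¹` field, applied to a fixed vector,
is jointly continuous. [folklore] -/
theorem continuous_fderiv_slice_apply {V : ℝ → E → E} (hV : ContDiff ℝ 1 (uncurry V)) (v : E) :
    Continuous fun z : ℝ × E => fderiv ℝ (V z.1) z.2 v := by
  have h : ∀ z : ℝ × E, fderiv ℝ (V z.1) z.2 v = fderiv ℝ (uncurry V) z (0, v) := fun z =>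
    fderiv_slice_apply (H := uncurry V) ((hV.differentiable one_ne_zero) _) v
  simp_rw [h]
  exact (hV.continuous_fderiv one_ne_zero).clm_apply continuous_const

omit [MeasurableSpace E] [BorelSpace E] in
/-- The space–time gradient tuple `z ↦ gradTuple (V z.1) z.2` of a jointly `C¹` field is
continuous. [folklore] -/
theorem continuous_gradTuple_slice {V : ℝ → E → E} (hV : ContDiff ℝ 1 (uncurry V)) :
    Continuous fun z : ℝ × E => gradTuple (V z.1) z.2 := by
  have hc : Continuous fun z : ℝ × E => fun i : Fin (Module.finrank ℝ E) =>
      fderiv ℝ (V z.1) z.2 (stdOrthonormalBasis ℝ E i) :=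
    continuous_pi fun i => continuous_fderiv_slice_apply hV _
  exact (PiLp.continuous_toLp 2 _).comp hc

omit [MeasurableSpace E] [BorelSpace E] in
/-- The space–time test tuple field `z ↦ testTuple (φ z.1) v c z.2` of a continuous `φ` is
continuous. [folklore] -/
theorem continuous_testTuple_slice {φ : ℝ → E → ℝ} (hφ : Continuous (uncurry φ)) (v c : E) :
    Continuous fun z : ℝ × E => testTuple (φ z.1) v c z.2 := by
  refine (PiLp.continuous_toLp 2 _).comp (continuous_pi fun i => ?_)
  exact (continuous_const.mul hφ).smul continuous_const

omit [MeasurableSpace E] [BorelSpace E] in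
/-- The test tuple field vanishes where `φ` does. [folklore] -/
theorem testTuple_slice_eq_zero {φ : ℝ → E → ℝ} {v c : E} {z : ℝ × E} (hz : φ z.1 z.2 = 0) :
    testTuple (φ z.1) v c z.2 = 0 := by
  simp only [testTuple, hz, mul_zero, zero_smul]
  rfl

omit [MeasurableSpace E] [BorelSpace E] in
/-- Pointwise pairing of a gradient tuple with a test tuple:
`⟪gradTuple (V t) x, testTuple (φ t) v c x⟫ = φ t x * ⟪D_x V(t, x) v, c⟫`. [folklore] -/
theorem inner_gradTuple_testTuple_slice (V : ℝ → E → E) (φ : ℝ → E → ℝ) (v c : E) (z : ℝ × E) :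
    ⟪gradTuple (V z.1) z.2, testTuple (φ z.1) v c z.2⟫ =
      φ z.1 z.2 * ⟪fderiv ℝ (V z.1) z.2 v, c⟫ := by
  rw [← inner_tupleToCLM_apply_smul, tupleToCLM_gradTuple_apply, real_inner_smul_right]

omit [MeasurableSpace E] [BorelSpace E] in
/-- Pointwise pairing of a tuple with a test tuple through the assembled operator:
`⟪γ, testTuple (φ t) v c x⟫ = φ t x * ⟪tupleToCLM (fun _ => γ) 0 v, c⟫`. [folklore] -/
theorem inner_testTuple_slice_eq (γ : GradTuple E) (φ : ℝ → E → ℝ) (v c : E) (z : ℝ × E) :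
    ⟪γ, testTuple (φ z.1) v c z.2⟫ = φ z.1 z.2 * ⟪tupleToCLM (fun _ : E => γ) 0 v, c⟫ := by
  rw [← tupleToCLM_const_eq γ z.2]
  have h := inner_tupleToCLM_apply_smul (fun _ : E => γ) (φ z.1) v c z.2
  rw [real_inner_smul_right] at h
  exact h.symm

end Tuple

/-! ### Auxiliary measure theory -/

section Aux

/-- An `L^p` function on an open set (with respect to the restricted Lebesgue measure),
`1 ≤ p`, is locally integrable on it. [folklore] -/
theorem locallyIntegrableOn_of_memLp_restrict {F : Type*} [NormedAddCommGroup F]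
    {Ω : Opens (ℝ × E)} {f : ℝ × E → F} {p : ℝ≥0∞} (hp : 1 ≤ p)
    (hf : MemLp f p (volume.restrict (Ω : Set (ℝ × E)))) :
    LocallyIntegrableOn f (Ω : Set (ℝ × E)) volume := by
  rw [locallyIntegrableOn_iff Ω.isOpen.isLocallyClosed]
  intro K hKΩ hK
  haveI : IsFiniteMeasure (volume.restrict K) := ⟨by
    rw [Measure.restrict_apply_univ]; exact hK.measure_lt_top⟩
  have h1 : MemLp f p (volume.restrict K) := by
    have := hf.restrict K
    rwa [Measure.restrict_restrict hK.measurableSet, inter_eq_left.2 hKΩ] at this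
  exact h1.integrable hp

omit [InnerProductSpace ℝ E] [FiniteDimensional ℝ E] [MeasurableSpace E] [BorelSpace E] in
/-- Slices of the space–time support: if `z ∉ tsupport φ` then `z.2 ∉ tsupport (φ z.1 ·)`.
[folklore] -/
private theorem notMem_tsupport_slice_aux {F : Type*} [Zero F] [TopologicalSpace F] {φ : ℝ → E → F}
    {z : ℝ × E} (hz : z ∉ tsupport (uncurry φ)) : z.2 ∉ tsupport (φ z.1) := by
  intro h
  have hsub : tsupport (φ z.1) ⊆ Prod.mk z.1 ⁻¹' tsupport (uncurry φ) := by
    refine closure_minimal (fun y hy => subset_tsupport _ ?_) ?_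
    · exact hy
    · exact (isClosed_tsupport _).preimage (Continuous.prodMk_right z.1)
  exact hz (hsub h)

omit [InnerProductSpace ℝ E] [FiniteDimensional ℝ E] [MeasurableSpace E] [BorelSpace E] in
/-- The spatial derivative of a slice of a space–time function vanishes off the space–time
support. [folklore] -/
private theorem fderiv_slice_eq_zero_of_notMem_tsupport_aux [NormedSpace ℝ E] {φ : ℝ → E → ℝ} {z : ℝ × E}
    (hz : z ∉ tsupport (uncurry φ)) : fderiv ℝ (φ z.1) z.2 = 0 :=
  fderiv_of_notMem_tsupport (𝕜 := ℝ) (notMem_tsupport_slice_aux hz)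

omit [InnerProductSpace ℝ E] [FiniteDimensional ℝ E] [MeasurableSpace E] [BorelSpace E] in
/-- The `L²` inner product of two classes built from functions is the integral of the pointwise
inner products (general measure space and inner-product codomain). [folklore] -/
private theorem inner_toLp_toLp_eq_integral_aux {X : Type*} [MeasurableSpace X] {μ : Measure X}
    {F' : Type*} [NormedAddCommGroup F'] [InnerProductSpace ℝ F'] {f g : X → F'}
    (hf : MemLp f 2 μ) (hg : MemLp g 2 μ) :
    ⟪hf.toLp f, hg.toLp g⟫ = ∫ x, ⟪f x, g x⟫ ∂μ := by
  rw [MeasureTheory.L2.inner_def]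
  refine integral_congr_ae ?_
  filter_upwards [hf.coeFn_toLp, hg.coeFn_toLp] with x hx hy
  rw [hx, hy]

end Aux

/-! ### The extraction theorem -/

section Extraction

set_option maxHeartbeats 400000 in
/-- **Weak spatial gradients from smooth approximations with bounded dissipation.** Let
`Ω ⊆ ℝ × E` be open, `u` locally integrable on `Ω`, and `Vₙ` jointly `C¹` fields with
`Vₙ → u` in `L¹(K)` for every compact `K ⊆ Ω` and `∫∫_Ω |D_x Vₙ|² ≤ L < ∞` for all `n`. Then
`u` has a weak spatial gradient `G` on `Ω` with `∫∫_Ω |G|² ≤ L` (weak sequential compactness of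
the bounded sequence of gradient tuples in `L²(Ω; E^d)`, Brezis 2011, Thm. 3.18, with the weak
lower semicontinuity of the norm, Prop. 3.5 (iii); the integration-by-parts identities of the
`C¹` slices pass to the limit, Evans, *PDE*, §5.2.1). [folklore] -/
theorem exists_hasWeakSpatialGradientOn_of_lintegral_fderiv_le {Ω : Opens (ℝ × E)}
    {u : ℝ → E → E} (hu : LocallyIntegrableOn (uncurry u) (Ω : Set (ℝ × E)) volume)
    {V : ℕ → ℝ → E → E} (hV : ∀ n, ContDiff ℝ 1 (uncurry (V n)))
    (hconv : ∀ K ⊆ (Ω : Set (ℝ × E)), IsCompact K →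
      Tendsto (fun n => eLpNorm (fun z => uncurry (V n) z - uncurry u z) 1 (volume.restrict K))
        atTop (𝓝 0))
    {L : ℝ≥0∞} (hL : L ≠ ∞)
    (hbd : ∀ n, ∫⁻ z in (Ω : Set (ℝ × E)),
      ENNReal.ofReal (frobeniusNormSq (fderiv ℝ (V n z.1) z.2)) ≤ L) :
    ∃ G : ℝ → E → E →L[ℝ] E, HasWeakSpatialGradientOn Ω u G ∧
      ∫⁻ z in (Ω : Set (ℝ × E)), ENNReal.ofReal (frobeniusNormSq (G z.1 z.2)) ≤ L := by
  haveI : Fact ((1 : ℝ≥0∞) ≤ 2) := ⟨one_le_two⟩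
  haveI : Fact ((2 : ℝ≥0∞) ≠ ∞) := ⟨ENNReal.ofNat_ne_top⟩
  set μ : Measure (ℝ × E) := volume.restrict (Ω : Set (ℝ × E)) with hμ
  have hΩm : MeasurableSet (Ω : Set (ℝ × E)) := Ω.isOpen.measurableSet
  -- ## the gradient tuples as a bounded sequence in `L²(Ω; E^d)`
  set g : ℕ → ℝ × E → GradTuple E := fun n z => gradTuple (V n z.1) z.2 with hg
  have hgc : ∀ n, Continuous (g n) := fun n => continuous_gradTuple_slice (hV n)
  have hg2 : ∀ n, eLpNorm (g n) 2 μ ^ 2 ≤ L := fun n => by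
    rw [MollifiedLimits.eLpNorm_two_pow_two]
    simp_rw [hg, enorm_gradTuple_slice_sq]
    exact hbd n
  have hgL : ∀ n, MemLp (g n) 2 μ := fun n => by
    refine ⟨(hgc n).aestronglyMeasurable, ?_⟩
    have h1 : eLpNorm (g n) 2 μ ^ 2 < ∞ := (hg2 n).trans_lt hL.lt_top
    by_contra htop
    rw [not_lt, top_le_iff] at htop
    rw [htop, ENNReal.top_pow two_ne_zero] at h1
    exact lt_irrefl _ h1
  set H := Lp (GradTuple E) 2 μ
  set w : ℕ → H := fun n => (hgL n).toLp (g n) with hw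
  set M : ℝ := (L ^ (1 / 2 : ℝ)).toReal with hM
  have hLhalf : L ^ (1 / 2 : ℝ) ≠ ∞ := ENNReal.rpow_ne_top_of_nonneg (by norm_num) hL
  have hwM : ∀ n, ‖w n‖ ≤ M := fun n => by
    rw [hw, Lp.norm_toLp, hM]
    refine ENNReal.toReal_mono hLhalf ?_
    have h1 : eLpNorm (g n) 2 μ = (eLpNorm (g n) 2 μ ^ 2) ^ (1 / 2 : ℝ) := by
      rw [← ENNReal.rpow_natCast, ← ENNReal.rpow_mul]; norm_num
    rw [h1]
    exact ENNReal.rpow_le_rpow (hg2 n) (by norm_num)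
  -- ## weak limit along a subsequence
  obtain ⟨κ, hκ, wl, hwlM, hweak⟩ :=
    FunctionSpaces.exists_strictMono_tendsto_inner_of_norm_le hwM
  -- the limit as an operator field
  set gl : ℝ × E → GradTuple E := (wl : ℝ × E → GradTuple E) with hgl
  have hglL : MemLp gl 2 μ := Lp.memLp wl
  have hglto : hglL.toLp gl = wl := Lp.toLp_coeFn wl (Lp.memLp wl)
  set G : ℝ → E → E →L[ℝ] E := fun t x => tupleToCLM (fun _ : E => gl (t, x)) 0 with hGdef
  have hGunc : uncurry G = fun z => tupleToCLM (fun _ : E => gl z) 0 := by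
    funext z; rfl
  have hGm : AEStronglyMeasurable (uncurry G) μ := by
    rw [hGunc]; exact continuous_tupleToCLM_const.comp_aestronglyMeasurable hglL.1
  have hGL : MemLp (uncurry G) 2 μ := by
    rw [hGunc]
    exact MemLp.of_le_mul (c := (Module.finrank ℝ E : ℝ)) hglL
      (continuous_tupleToCLM_const.comp_aestronglyMeasurable hglL.1)
      (Eventually.of_forall fun z => norm_tupleToCLM_le (fun _ : E => gl z) 0)
  have hGli : LocallyIntegrableOn (uncurry G) (Ω : Set (ℝ × E)) volume :=
    locallyIntegrableOn_of_memLp_restrict one_le_two hGL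
  -- ## the dissipation bound of the limit
  have hbound : ∫⁻ z in (Ω : Set (ℝ × E)), ENNReal.ofReal (frobeniusNormSq (G z.1 z.2)) ≤ L := by
    have h1 : ∀ z : ℝ × E, ENNReal.ofReal (frobeniusNormSq (G z.1 z.2)) = ‖gl z‖ₑ ^ 2 := fun z => by
      change ENNReal.ofReal (frobeniusNormSq (tupleToCLM (fun _ : E => gl z) 0)) = _
      rw [frobeniusNormSq_tupleToCLM, ← ofReal_norm, ENNReal.ofReal_pow (norm_nonneg _)]
    simp_rw [h1]
    rw [← MollifiedLimits.eLpNorm_two_pow_two]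
    change eLpNorm gl 2 μ ^ 2 ≤ L
    have h2 : eLpNorm gl 2 μ = ENNReal.ofReal ‖wl‖ := by
      rw [← hglto, Lp.norm_toLp, ENNReal.ofReal_toReal hglL.eLpNorm_ne_top]
    rw [h2]
    have hM0 : 0 ≤ M := ENNReal.toReal_nonneg
    calc ENNReal.ofReal ‖wl‖ ^ 2 ≤ ENNReal.ofReal M ^ 2 := by
          gcongr
      _ = L := by
          rw [hM, ENNReal.ofReal_toReal hLhalf, ← ENNReal.rpow_natCast, ← ENNReal.rpow_mul]
          norm_num
  refine ⟨G, ⟨hu, hGli, fun φ hφ v c => ?_⟩, hbound⟩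
  -- ## the integration-by-parts identity in the limit
  set K : Set (ℝ × E) := tsupport (uncurry φ) with hK
  have hKc : IsCompact K := hφ.hasCompactSupport
  have hKΩ : K ⊆ (Ω : Set (ℝ × E)) := hφ.tsupport_subset
  have hKm : MeasurableSet K := hKc.measurableSet
  have cφ : Continuous (uncurry φ) := hφ.contDiff.continuous
  -- the weight `θ = ∂ᵥφ` and its properties
  set θ : ℝ × E → ℝ := fun z => fderiv ℝ (φ z.1) z.2 v with hθ
  have hθeq : ∀ z : ℝ × E, θ z = fderiv ℝ (uncurry φ) z (0, v) := fun z =>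
    fderiv_slice_apply (H := uncurry φ) ((hφ.contDiff.differentiable (by simp)) _) v
  have cθ : Continuous θ := by
    have : θ = fun z => fderiv ℝ (uncurry φ) z (0, v) := funext hθeq
    rw [this]
    exact (hφ.contDiff.continuous_fderiv (by simp)).clm_apply continuous_const
  have hθK : ∀ z ∉ K, θ z = 0 := fun z hz => by
    simp [hθ, fderiv_slice_eq_zero_of_notMem_tsupport_aux hz]
  have hφK : ∀ z ∉ K, φ z.1 z.2 = 0 := fun z hz =>
    show uncurry φ z = 0 from image_eq_zero_of_notMem_tsupport hz
  obtain ⟨Cθ, hCθ⟩ := cθ.bounded_above_of_compact_support (HasCompactSupport.intro hKc hθK)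
  -- ### (1) slice-wise integration by parts for the smooth fields
  have hIBP : ∀ n, ∫ t, ∫ x, θ (t, x) * ⟪V n t x, c⟫ =
      -∫ t, ∫ x, φ t x * ⟪fderiv ℝ (V n t) x v, c⟫ := by
    intro n
    rw [← integral_neg]
    refine integral_congr_ae (Eventually.of_forall fun t => ?_)
    have hVt : ContDiff ℝ 1 (V n t) := contDiff_slice (H := uncurry (V n)) (hV n) t
    have hφt : FunctionSpaces.IsTestFunctionOn (⊤ : Opens E) (φ t) :=
      ⟨hφ.contDiff_slice t, hφ.hasCompactSupport_slice t, fun _ _ => trivial⟩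
    have key := (FunctionSpaces.HasWeakFDerivOn.of_contDiff_holds ⊤ volume hVt).integral_fderiv_smul_eq
      (φ t) v hφt
    simp only [Opens.coe_top, Measure.restrict_univ] at key
    have i1 : Integrable (fun x => (fderiv ℝ (φ t) x v) • V n t x) (volume : Measure E) :=
      ((cθ.comp (Continuous.prodMk_right t)).smul
        ((hV n).continuous.comp (Continuous.prodMk_right t))).integrable_of_hasCompactSupport
        (((hφ.hasCompactSupport_slice t).fderiv_apply (𝕜 := ℝ) v).smul_right)
    have i2 : Integrable (fun x => φ t x • fderiv ℝ (V n t) x v) (volume : Measure E) :=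
      ((cφ.comp (Continuous.prodMk_right t)).smul
        ((continuous_fderiv_slice_apply (hV n) v).comp (Continuous.prodMk_right t)))
        |>.integrable_of_hasCompactSupport (hφ.hasCompactSupport_slice t).smul_right
    have e1 : ∫ x, θ (t, x) * ⟪V n t x, c⟫ = ⟪c, ∫ x, (fderiv ℝ (φ t) x v) • V n t x⟫ := by
      rw [← integral_inner i1 c]
      refine integral_congr_ae (Eventually.of_forall fun x => ?_)
      simp only [hθ, real_inner_smul_right, real_inner_comm c]
    have e2 : ∫ x, φ t x * ⟪fderiv ℝ (V n t) x v, c⟫ = ⟪c, ∫ x, φ t x • fderiv ℝ (V n t) x v⟫ := by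
      rw [← integral_inner i2 c]
      refine integral_congr_ae (Eventually.of_forall fun x => ?_)
      simp only [real_inner_smul_right, real_inner_comm c]
    dsimp only
    rw [e1, e2, key, inner_neg_right]
  -- ### (2) convergence of the field side
  have hA : Tendsto (fun n => ∫ t, ∫ x, θ (t, x) * ⟪V n t x, c⟫) atTop
      (𝓝 (∫ t, ∫ x, θ (t, x) * ⟪u t x, c⟫)) := by
    -- product-integral forms, supported in `K`
    have iAn : ∀ n, Integrable (fun z : ℝ × E => θ z * ⟪V n z.1 z.2, c⟫) (volume : Measure (ℝ × E)) :=
      fun n => (cθ.mul (((hV n).continuous).inner continuous_const)).integrable_of_hasCompactSupport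
        ((HasCompactSupport.intro hKc hθK).mul_right)
    have iA : Integrable (fun z : ℝ × E => θ z * ⟪u z.1 z.2, c⟫) (volume : Measure (ℝ × E)) :=
      integrable_mul_inner_of_locallyIntegrableOn hu cθ hKc hKΩ hθK c
    have eAn : ∀ n, ∫ t, ∫ x, θ (t, x) * ⟪V n t x, c⟫ =
        ∫ z in K, θ z * ⟪V n z.1 z.2, c⟫ := fun n => by
      have h1 : ∫ z, θ z * ⟪V n z.1 z.2, c⟫ ∂(volume : Measure (ℝ × E)) =
          ∫ t, ∫ x, θ (t, x) * ⟪V n t x, c⟫ := by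
        rw [Measure.volume_eq_prod, integral_prod _ (by simpa [Measure.volume_eq_prod] using iAn n)]
      rw [← h1, setIntegral_eq_integral_of_forall_compl_eq_zero fun z hz => by
        rw [hθK z hz, zero_mul]]
    have eA : ∫ t, ∫ x, θ (t, x) * ⟪u t x, c⟫ = ∫ z in K, θ z * ⟪u z.1 z.2, c⟫ := by
      have h1 : ∫ z, θ z * ⟪u z.1 z.2, c⟫ ∂(volume : Measure (ℝ × E)) =
          ∫ t, ∫ x, θ (t, x) * ⟪u t x, c⟫ := by
        rw [Measure.volume_eq_prod, integral_prod _ (by simpa [Measure.volume_eq_prod] using iA)]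
      rw [← h1, setIntegral_eq_integral_of_forall_compl_eq_zero fun z hz => by
        rw [hθK z hz, zero_mul]]
    simp_rw [eAn, eA]
    -- `L¹(K)` convergence of the pairings `⟪Vₙ, c⟫ → ⟪u, c⟫`
    have huK : IntegrableOn (uncurry u) K volume := hu.integrableOn_compact_subset hKΩ hKc
    have hVK : ∀ n, IntegrableOn (uncurry (V n)) K volume := fun n =>
      ((hV n).continuous.continuousOn).integrableOn_compact hKc
    have hΦn : ∀ n, Integrable (fun z : ℝ × E => ⟪V n z.1 z.2, c⟫) (volume.restrict K) :=
      fun n => (hVK n).inner_const c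
    have hΦ : Integrable (fun z : ℝ × E => ⟪u z.1 z.2, c⟫) (volume.restrict K) := huK.inner_const c
    have hL1 : Tendsto (fun n => eLpNorm ((fun z : ℝ × E => ⟪V n z.1 z.2, c⟫) -
        fun z : ℝ × E => ⟪u z.1 z.2, c⟫) 1 (volume.restrict K)) atTop (𝓝 0) := by
      have hb : ∀ n, eLpNorm ((fun z : ℝ × E => ⟪V n z.1 z.2, c⟫) -
          fun z : ℝ × E => ⟪u z.1 z.2, c⟫) 1 (volume.restrict K) ≤
          ENNReal.ofReal ‖c‖ * eLpNorm (fun z => uncurry (V n) z - uncurry u z) 1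
            (volume.restrict K) := by
        intro n
        refine eLpNorm_le_mul_eLpNorm_of_ae_le_mul (Eventually.of_forall fun z => ?_) 1
        simp only [Pi.sub_apply]
        rw [← inner_sub_left]
        calc ‖⟪V n z.1 z.2 - u z.1 z.2, c⟫‖ ≤ ‖V n z.1 z.2 - u z.1 z.2‖ * ‖c‖ :=
              norm_inner_le_norm _ _
          _ = ‖c‖ * ‖uncurry (V n) z - uncurry u z‖ := by
              rw [mul_comm]; rfl
      have hlim : Tendsto (fun n => ENNReal.ofReal ‖c‖ *
          eLpNorm (fun z => uncurry (V n) z - uncurry u z) 1 (volume.restrict K)) atTop (𝓝 0) := by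
        have := ENNReal.Tendsto.const_mul (hconv K hKΩ hKc) (a := ENNReal.ofReal ‖c‖)
          (Or.inr ENNReal.ofReal_ne_top)
        simpa only [mul_zero] using this
      exact tendsto_of_tendsto_of_tendsto_of_le_of_le tendsto_const_nhds hlim
        (fun n => zero_le) hb
    have key := tendsto_setIntegral_mul_of_tendsto_eLpNorm_one (μ := volume.restrict K)
      (cθ.aestronglyMeasurable) (Eventually.of_forall hCθ) hΦn hΦ hL1 univ
    simp only [Measure.restrict_univ] at key
    exact key
  -- ### (3) convergence of the gradient side along the subsequence
  set ζ : ℝ × E → GradTuple E := fun z => testTuple (φ z.1) v c z.2 with hζ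
  have cζ : Continuous ζ := continuous_testTuple_slice cφ v c
  have hζK : ∀ z ∉ K, ζ z = 0 := fun z hz => testTuple_slice_eq_zero (hφK z hz)
  have hζL : MemLp ζ 2 μ :=
    (cζ.memLp_of_hasCompactSupport (HasCompactSupport.intro hKc hζK)).restrict _
  -- pairings in `H` are the iterated integrals
  have hpair_n : ∀ n, ⟪w n, hζL.toLp ζ⟫ = ∫ t, ∫ x, φ t x * ⟪fderiv ℝ (V n t) x v, c⟫ := by
    intro n
    rw [hw, inner_toLp_toLp_eq_integral_aux (hgL n) hζL]
    have i1 : Integrable (fun z : ℝ × E => φ z.1 z.2 * ⟪fderiv ℝ (V n z.1) z.2 v, c⟫)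
        (volume : Measure (ℝ × E)) :=
      (cφ.mul ((continuous_fderiv_slice_apply (hV n) v).inner continuous_const))
        |>.integrable_of_hasCompactSupport ((HasCompactSupport.intro hKc hφK).mul_right)
    have e1 : ∫ z, ⟪g n z, ζ z⟫ ∂μ = ∫ z in (Ω : Set (ℝ × E)),
        φ z.1 z.2 * ⟪fderiv ℝ (V n z.1) z.2 v, c⟫ :=
      integral_congr_ae (Eventually.of_forall fun z => inner_gradTuple_testTuple_slice (V n) φ v c z)
    rw [e1, setIntegral_eq_integral_of_forall_compl_eq_zero fun z hz => by
      rw [hφK z (fun h => hz (hKΩ h)), zero_mul], Measure.volume_eq_prod,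
      integral_prod _ (by simpa [Measure.volume_eq_prod] using i1)]
  have hpair_l : ⟪wl, hζL.toLp ζ⟫ = ∫ t, ∫ x, φ t x * ⟪G t x v, c⟫ := by
    rw [← hglto, inner_toLp_toLp_eq_integral_aux hglL hζL]
    have i1 : Integrable (fun z : ℝ × E => φ z.1 z.2 * ⟪G z.1 z.2 v, c⟫)
        (volume : Measure (ℝ × E)) :=
      integrable_mul_inner_apply_of_locallyIntegrableOn hGli cφ hKc hKΩ hφK v c
    have e1 : ∫ z, ⟪gl z, ζ z⟫ ∂μ = ∫ z in (Ω : Set (ℝ × E)), φ z.1 z.2 * ⟪G z.1 z.2 v, c⟫ :=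
      integral_congr_ae (Eventually.of_forall fun z => inner_testTuple_slice_eq (gl z) φ v c z)
    rw [e1, setIntegral_eq_integral_of_forall_compl_eq_zero fun z hz => by
      rw [hφK z (fun h => hz (hKΩ h)), zero_mul], Measure.volume_eq_prod,
      integral_prod _ (by simpa [Measure.volume_eq_prod] using i1)]
  have hB : Tendsto (fun k => ∫ t, ∫ x, φ t x * ⟪fderiv ℝ (V (κ k) t) x v, c⟫) atTop
      (𝓝 (∫ t, ∫ x, φ t x * ⟪G t x v, c⟫)) := by
    have h := hweak (hζL.toLp ζ)
    simp_rw [hpair_n, hpair_l] at h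
    exact h
  -- ### (4) conclusion
  have hA' := hA.comp hκ.tendsto_atTop
  have hA'' : Tendsto (fun k => ∫ t, ∫ x, θ (t, x) * ⟪V (κ k) t x, c⟫) atTop
      (𝓝 (-∫ t, ∫ x, φ t x * ⟪G t x v, c⟫)) := by
    have : (fun k => ∫ t, ∫ x, θ (t, x) * ⟪V (κ k) t x, c⟫) =
        fun k => -∫ t, ∫ x, φ t x * ⟪fderiv ℝ (V (κ k) t) x v, c⟫ := funext fun k => hIBP (κ k)
    rw [this]
    exact hB.neg
  exact tendsto_nhds_unique hA' hA''

end Extraction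

end Literature.Analysis.FluidPDE
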